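import Literature.AnabelianGeometry.EtaleTheta.TemperedFrobenioidOfThetaTwistTowerSmallIndex
import HarnessLib

/-!
# [EtTh] §5 at the SMALL-INDEXED (β) theta-tower carrier: the class of the ZERO divisor of `Θ̈` is fixed by every covering automorphism — the junction input `hθ` at abc-iut-L2-t3's §4-socket-able model `temperedFrobenioidSmall` (Prop. 1.4 (i) p.244, §5 p.330 / PDF pp.18, 104)

S. Mochizuki, *The étale theta function and its Frobenioid-theoretic manifestations*, Publ. RIMS **45** (2009) [MochizukiEtTh2009],
Prop. 1.4 (i) p.244 (PDF p.18) (the zero divisor of `Θ̈`: all cusps, multiplicity one, permuted by `Π^tp_X`), §5 p.330 (PDF p.104)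
(«the zero divisor `Div(s^⊓_N)` … descends»), Prop. 4.3 (i) proof p.317 (PDF p.91).
[cite: MochizukiEtTh2009, Prop 1.4 (i) p.244 (PDF p.18); §5 p.330 (PDF p.104)]

abc-iut cell, layer L2 = [EtTh], seat abc-iut-L2-t11 (gen 10); abc-iut-L2-lead R1215 rider «also against `temperedFrobenioidSmall`».
PROOF-ONLY (0 definitions); nothing landed is edited.  SIBLING of this seat's `Discharge/Sec5ThetaZerosPullInvariantThetaTwistTower.lean`
(p501806, the same fact at abc-iut-L2-d2's FILE 4 `ThetaTwistTowerTempered.temperedFrobenioid`), here at abc-iut-L2-t3's RE-INDEXED model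
`ThetaTwistTowerSmallIndex.temperedFrobenioidSmall R S` (p501267: Def. 3.3 (iii) data `dmSmall` over the small coset model, base functor
`B^temp(Compat₃′)⁰ ⥤ CosetCat Compat₃′` the equivalence inverse) — the model that ENTERS a §4 setting (`settingSmall … .tf = temperedFrobenioidSmall`,
`settingSmall_tf`), i.e. the carrier at which abc-iut-L2-t3's junction census (R1208) reads the input `hθ`.  Kept in a separate module so that
FILE-4-only consumers of p501806 do not inherit the small-index / quotient-temperoid import closure.

WHAT IS PROVED: `ThetaTwistTowerSmallIndex.pull_divisorMonoid_thetaZeros_small` / `_aut` — the class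
`ι(div₀ Θ̈) ∈ Φ(A)` of the zero divisor of `Θ̈` (FILE 4's constant equivariant family `TateTowerTheta.thetaZerosPhi` read on the coset
re-presentation `repr A`; the element exhibited by p501267's `exists_mem_Φ_not_mem_bsFld_small`) is FIXED under `pull (temperedFrobenioidSmall R S).divisorMonoid g`
for every endomorphism / automorphism `g` of every connected covering `A` — route as in p501806: the weak realification engine on the image of
`Φ₀` (`rlfMapWeak_toRealification_of dmSmall.Φ₀ hpfSmall`), FILE 4's transition «pull back, then `^eN`» (`Φ₀_map_hom_eq`) at
`toConn.map (equivConn.inverse.map g)`, `eN i i = 1`, and the constant family pulls back to itself.  With the fraction pair `Pl` of `Θ̈`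
chosen at this carrier with `div Pl.num := ι(div₀ Θ̈)`, this is the literal `hθ` of `hinvc_of_thetaDivisor` / `hinvc_ofQuotientTemperoid`.
HONEST FRAMING: kernel facts about OUR model carrier (a class-(b) combinatorial design model, p501267's label); nothing of [EtTh] is asserted
or denied; no side taken on [IUTchIII] Cor. 3.12; typed ≠ proved.
-/

noncomputable section

namespace Literature.AnabelianGeometry.EtaleTheta

open CategoryTheory Opposite Function Literature.AlgebraicGeometry.Frobenioids Literature.AnabelianGeometry.SemiGraphs

namespace ThetaTwistTowerSmallIndex

open LogDivisorModel.TateTowerThetaTwist TateTowerKummerTwistRShear ThetaTwistTowerTempered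
open TateTowerKummerTwist (eN eN_self)

variable (R S : ((ConnectedPart (BTemp (Compat 3 thetaShear)))ᵒᵖ ⥤ CommMonCat.{0}) → Prop)

/-- **At the small-indexed model: the zero-divisor class of `Θ̈` is FIXED by every endomorphism of every connected covering** (the content
of the junction input `hθ` — §5 p.330 «`Div(s^⊓_N)` descends»; Prop. 4.3 (i) proof — at abc-iut-L2-t3's `temperedFrobenioidSmall R S`, whose
`Φ₀` at `A` is FILE 4's `Φ₀` at the coset re-presentation `repr A`).
[cite: MochizukiEtTh2009, Prop 1.4 (i) p.244 (PDF p.18); §5 p.330 (PDF p.104); Prop 4.3 (i) p.317 (PDF p.91)] -/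
theorem pull_divisorMonoid_thetaZeros_small {A : ConnectedPart (BTemp (Compat 3 thetaShear))} (g : A ⟶ A) :
    pull (temperedFrobenioidSmall R S).divisorMonoid g
        ⟨(hpfSmall (op (equivConn.inverse.obj A))).weak.toRealification
            (Perfection.of _ (LogDivisorModel.TateTowerTheta.thetaZerosPhi φ₃ (LogDivisorTower.gset (repr A)))),
          ⟨_, rfl⟩⟩ =
      ⟨(hpfSmall (op (equivConn.inverse.obj A))).weak.toRealification
            (Perfection.of _ (LogDivisorModel.TateTowerTheta.thetaZerosPhi φ₃ (LogDivisorTower.gset (repr A)))),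
          ⟨_, rfl⟩⟩ := by
  apply Subtype.ext
  -- the constant family pulls back to the constant family (along the coset re-presentation of `g`)
  have hψ : (LogDivisorModel.TateTowerTheta.action φ₃).phiZeroPull (toConn.map (equivConn.inverse.map g)).hom.hom
        (LogDivisorModel.TateTowerTheta.thetaZerosPhi φ₃ (LogDivisorTower.gset (repr A))) =
      LogDivisorModel.TateTowerTheta.thetaZerosPhi φ₃ (LogDivisorTower.gset (repr A)) :=
    Subtype.ext (funext fun _ => rfl)
  -- FILE 4's transition of `Φ₀` along the re-presented endomorphism: pull back, then raise to `eN i i = 1`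
  have h2 : (dmSmall.Φ₀.map (equivConn.inverse.map g).op).hom
        (LogDivisorModel.TateTowerTheta.thetaZerosPhi φ₃ (LogDivisorTower.gset (repr A))) =
      LogDivisorModel.TateTowerTheta.thetaZerosPhi φ₃ (LogDivisorTower.gset (repr A)) := by
    change (dm.Φ₀.map (toConn.map (equivConn.inverse.map g)).op).hom _ = _
    rw [Φ₀_map_hom_eq]
    change (LogDivisorModel.TateTowerTheta.action φ₃).phiZeroPull (toConn.map (equivConn.inverse.map g)).hom.hom
        (LogDivisorModel.TateTowerTheta.thetaZerosPhi φ₃ (LogDivisorTower.gset (repr A))) ^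
          eN (lvlC 3 thetaShear (repr A)) (lvlC 3 thetaShear (repr A)) = _
    rw [eN_self, pow_one, hψ]
  -- the weak realification engine on the image of `Φ₀`
  have h1 := rlfMapWeak_toRealification_of dmSmall.Φ₀ hpfSmall (equivConn.inverse.map g).op
    (LogDivisorModel.TateTowerTheta.thetaZerosPhi φ₃ (LogDivisorTower.gset (repr A)))
  rw [h2] at h1
  exact h1

/-- The same for automorphisms `g ∈ Aut(A)` (the quantifier shape of `hinvc` / of `hθ` through `Π^tp ↠ Aut(A^bs)` at the small-indexed
§4 setting `settingSmall`).  [cite: MochizukiEtTh2009, §5 p.330 (PDF p.104)] -/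
theorem pull_divisorMonoid_thetaZeros_small_aut {A : ConnectedPart (BTemp (Compat 3 thetaShear))} (g : Aut A) :
    pull (temperedFrobenioidSmall R S).divisorMonoid g.hom
        ⟨(hpfSmall (op (equivConn.inverse.obj A))).weak.toRealification
            (Perfection.of _ (LogDivisorModel.TateTowerTheta.thetaZerosPhi φ₃ (LogDivisorTower.gset (repr A)))),
          ⟨_, rfl⟩⟩ =
      ⟨(hpfSmall (op (equivConn.inverse.obj A))).weak.toRealification
            (Perfection.of _ (LogDivisorModel.TateTowerTheta.thetaZerosPhi φ₃ (LogDivisorTower.gset (repr A)))),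
          ⟨_, rfl⟩⟩ :=
  pull_divisorMonoid_thetaZeros_small R S g.hom

end ThetaTwistTowerSmallIndex

end Literature.AnabelianGeometry.EtaleTheta

end
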